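import Literature.MathematicalPhysics.QuantumFieldTheory.Balaban1983to89.HaarAnalyticZeroSetNullLocalPi
import Literature.MathematicalPhysics.QuantumFieldTheory.Balaban1983to89.HaarDist1LevelHypersurface
import Literature.MathematicalPhysics.QuantumFieldTheory.Balaban1983to89.UnitaryModel

/-!
# `Balaban1983to89.HaarAnalyticZeroSetNullLocalNormThreshold` — OPERATOR-NORM SMALL-FIELD CONDITIONS `|w(U) − 1| < ε` OF
# REAL-ANALYTIC UNITARY-VALUED FUNCTIONALS ARE `dU`-A.E. LOCALLY CONSTANT (hence their sharp characteristic functions are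
# a.e. continuous) — for `w` real-analytic ONLY ON AN OPEN SET of configurations, with NO connectedness, NO witness and
# NO surjectivity hypothesis: the exact shape of the (2.17) cube conditions `sup_{p ⊂ □̃} |U_{k,□}(V_k, ∂p) − 1| < ε_k`

statement-level skeleton of published theorems with citation tags; proofs where landed; nothing here is a claim
about the Yang–Mills mass gap

Cell `pub-ymgap` (YM-PLAN Track A), node N09 [B12] width seat `pub-ymgap-dag-n09-w3` (g4), `--supports` K1⁷
`StabilityBAtRecordR13SepCoPH` = stmt-QuantumFields-20542 as a count-neutral helper.  File 6 of this seat's OPEN-SET (local)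
edition of the real-analytic zero-set nullity (files 1–5: `HaarAnalyticZeroSetNullLocal`, `…LocalPiEngine`, `…LocalPi`,
`…LocalGroups`, `…LocalCutoff`).  THE POINT.  Print's small-field thresholds are OPERATOR-NORM conditions `|W − 1| < ε`
([Balaban1985Averaging] (19) p. 21: `|W − 1|` the L²-operator norm), and `W ↦ ‖W − 1‖` is not analytic.  This seat's g3 file
`HaarDist1LevelHypersurface` supplied the level equation `‖W − 1‖ = r ⇒ det((r² − 2)·1 + W + Wᴴ) = 0` for unitary `W`; §1 here
adds the CONVERSE INEQUALITY `det((r² − 2)·1 + W + Wᴴ) = 0 ⇒ r ≤ ‖W − 1‖` (a kernel vector `v` of the level matrix has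
`|(W − 1)v|² = r²|v|²` by `(W − 1)ᴴ(W − 1) = 2·1 − W − Wᴴ`).  With the flat-locus theorem of file 3 applied to the
real-analytic level function `D_r = det((r² − 2)·1 + w + wᴴ)` of a unitary-valued `w` real-analytic on an open `W`: at a.e.
configuration either `D_r ≠ 0` (so `‖w − 1‖ ≠ r`, and the condition `‖w − 1‖ < r` is locally constant by continuity) or
`D_r ≡ 0` nearby (so `‖w − 1‖ ≥ r` nearby and the condition is locally FALSE).  LOCATED CONSUMER (pub-ymgap NODE 00 ∕ N09;
dag-n09-w3 g3 `HANDOFF.md` §g3.3, header of `Summits/…/BalabanUVNodesN09ContourThresholdNull`): the (2.17) small-field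
functions `Node00.chiOfRecord` threshold `sup_p |U_{k,□}(V_k, ∂p) − 1|` on the LOCAL minimiser; with this file their
`dU`-a.e. continuity needs only «`V ↦ U_{k,□}(V_k, ∂p)` is real-analytic (and unitary-valued) on the small-field domain» —
N07's ∕ (F1)'s ∕ def-R's content, NOT claimed here.

CITATION HEADER.  [Balaban1985Averaging] T. Bałaban, CMP **98** (1985) 17–51, (19) p. 21 (`|U − 1|`, the operator norm),
(10) p. 19 (`dU` = `Setup.fieldMeasure`).  [HornJohnson2013] R. A. Horn, C. R. Johnson, *Matrix Analysis* (2nd ed., CUP 2013),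
§5.6 (the spectral norm `‖A‖₂`, `‖Av‖ ≤ ‖A‖₂‖v‖`), §0.5 (singular matrices have kernel vectors).  [BrockerTomDieck1985]
IV (2.11) (proof principle; through files 1–3).  [Mityagin2015] Prop. 1 (PROVED in the tree; through files 1–3).
[Balaban1987RG1] T. Bałaban, CMP **109** (1987), (2.17) p. 266 (the located consumer; nothing of the paper asserted).

WHAT IS PROVED (theorems only; 0 definitions, 0 named facts, 0 sorry; axioms standard).  `M_m(ℂ)` with the L²-operator
norm (`Matrix.Norms.L2Operator`), `m` a non-empty finite type; the LEVEL MATRIX `(r² − 2)·1 + W + Wᴴ`.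
* §1 LINEAR ALGEBRA — `star_dotProduct_sub_one_mulVec` (for unitary `W` and `((c·1 + W + Wᴴ)v = 0`:
  `⟨(W−1)v, (W−1)v⟩ = (c + 2)⟨v, v⟩`), ★★ `le_norm_sub_one_of_det_level_eq_zero` (unitary `W`, `0 ≤ r`,
  `det((r² − 2)·1 + W + Wᴴ) = 0 ⇒ r ≤ ‖W − 1‖`), `norm_sub_one_ne_of_det_level_ne_zero` (contrapositive of the g3 level
  equation: `det ≠ 0 ⇒ ‖W − 1‖ ≠ r`).
* §2 POINTWISE CORE — ★ `eventually_norm_sub_one_lt_iff` (topological space `X`, `w : X → M_m(ℂ)` continuous at `x` and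
  unitary-valued near `x`, `D_r` not zero at `x` OR identically zero near `x` ⇒ `{‖w − 1‖ < r}` is locally constant at `x`).
* §3 A.E. THEOREMS (setting of files 1–3: `h : IsChartRep C ρ`, `hlie`, `G` compact, `μ` ANY Haar measure, finite `ι`,
  `W ⊆ 𝔸^ι` open, `w : 𝔸^ι → M_m(ℂ)` real-analytic on `W`, unitary-valued on the trace) — `analyticOnNhd_det_level_comp'`
  (the level function is real-analytic on `W`, g3's `analyticOnNhd_det_level_comp`), ★★★ `ae_pi_eventually_norm_sub_one_lt_iff`
  (`(⊗_ι μ)`-a.e. `g` with `ρ∘g ∈ W`: `∀ᶠ g', ‖w(ρ∘g') − 1‖ < r ↔ ‖w(ρ∘g) − 1‖ < r`), ★★ `ae_pi_continuousAt_ite_norm_sub_one_lt`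
  (the sharp cut-off `𝟙[‖w − 1‖ < r]` is a.e. continuous), ★★ `ae_pi_eventually_forall_norm_sub_one_lt_iff` (a finite family
  `w_p`, levels `r_p`: the joint condition `{∀ p, ‖w_p − 1‖ < r_p}` — the (2.17) shape — is a.e. locally constant).
* §4 THE GAUGE-FIELD MEASURE — ★★★ `fieldMeasure_ae_eventually_forall_norm_sub_one_lt_iff`,
  ★★ `fieldMeasure_ae_continuousAt_ite_forall_norm_sub_one_lt` (`dU = Setup.fieldMeasure P j (SU N)`; `SU(N)`-configurations).

HONEST SCOPE.  (i) Only the STRICT condition `<` (print's); for `≤` the flat branch does not decide local constancy.  (ii) The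
centre of the threshold is `1` (print's); `w` must be unitary on the trace of `W` (plaquette ∕ contour variables of unitary
configurations are).  (iii) Whether `{‖w − 1‖ = r}` is null is NOT decided (not needed for a.e. continuity).  (iv) Nothing of
files 1–5, of `HaarDist1LevelHypersurface` or of Mathlib is re-proved.  (v) No claim about Bałaban's renormalization group: no
threshold functional of the record is constructed; `hreg`∕`contTOn`∕`chiOfRecord` stay untouched; N09 is NOT discharged; nothing
continuum ∕ OS ∕ mass gap ∕ Clay.
-/

noncomputable section

open NormedSpace Set Function Filter Topology MeasureTheory
open scoped ENNReal NNReal Matrix.Norms.L2Operator ComplexOrder InnerProductSpace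

namespace Literature.MathematicalPhysics.QuantumFieldTheory.Balaban1983to89.HaarAnalyticZeroSetNullLocalNormThreshold

open Matrix WithLp
open HaarExponentialChart HaarExponentialChart.IsChartRep
open HaarAnalyticZeroSetNullLocal HaarAnalyticZeroSetNullLocalPiEngine HaarAnalyticZeroSetNullLocalPi
open HaarDist1LevelHypersurface (det_level_eq_zero_of_norm_sub_one_eq analyticOnNhd_det_level_comp)

/-! ## §1 Linear algebra: the converse inequality of the level equation -/

section LinearAlgebra

variable {m : Type*} [Fintype m] [DecidableEq m]

/-- For a unitary `W` and a kernel vector `v` of the level matrix `c·1 + W + Wᴴ`: `⟨(W − 1)v, (W − 1)v⟩ = (c + 2)·⟨v, v⟩`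
(because `(W − 1)ᴴ(W − 1) = 2·1 − W − Wᴴ = (c + 2)·1 − (c·1 + W + Wᴴ)`). [cite: HornJohnson2013, §5.6] -/
theorem star_dotProduct_sub_one_mulVec {W : Matrix m m ℂ} (hW : W ∈ Matrix.unitaryGroup m ℂ) {c : ℂ} {v : m → ℂ}
    (hv : (c • (1 : Matrix m m ℂ) + W + W.conjTranspose) *ᵥ v = 0) :
    star ((W - 1) *ᵥ v) ⬝ᵥ ((W - 1) *ᵥ v) = (c + 2) * (star v ⬝ᵥ v) := by
  have hWW : W.conjTranspose * W = 1 := by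
    have := Matrix.mem_unitaryGroup_iff'.mp hW
    rwa [Matrix.star_eq_conjTranspose] at this
  have key : (W - 1).conjTranspose * (W - 1) =
      (c + 2) • (1 : Matrix m m ℂ) - (c • (1 : Matrix m m ℂ) + W + W.conjTranspose) := by
    rw [Matrix.conjTranspose_sub, Matrix.conjTranspose_one, sub_mul, one_mul, mul_sub, mul_one, hWW, add_smul, two_smul]
    abel
  rw [Matrix.star_mulVec, ← Matrix.dotProduct_mulVec, Matrix.mulVec_mulVec, key, Matrix.sub_mulVec, hv, sub_zero,
    Matrix.smul_mulVec, Matrix.one_mulVec, dotProduct_smul, smul_eq_mul]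

/-- ★★ **THE CONVERSE INEQUALITY OF THE LEVEL EQUATION**: for a unitary `W` and `0 ≤ r`, if `det((r² − 2)·1 + W + Wᴴ) = 0`
then `r ≤ ‖W − 1‖` (L²-operator norm): a kernel vector `v ≠ 0` of the level matrix has `|(W − 1)v| = r|v| ≤ ‖W − 1‖·|v|`.
[cite: HornJohnson2013, §5.6 (‖Av‖ ≤ ‖A‖₂‖v‖), §0.5] [cite: Balaban1985Averaging, (19) p.21] -/
theorem le_norm_sub_one_of_det_level_eq_zero {W : Matrix m m ℂ} (hW : W ∈ Matrix.unitaryGroup m ℂ) {r : ℝ} (hr : 0 ≤ r)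
    (hdet : (((r ^ 2 - 2 : ℝ) : ℂ) • (1 : Matrix m m ℂ) + W + W.conjTranspose).det = 0) :
    r ≤ ‖W - 1‖ := by
  obtain ⟨v, hv0, hv⟩ := Matrix.exists_mulVec_eq_zero_iff.2 hdet
  have hq := star_dotProduct_sub_one_mulVec hW hv
  have hc : ((r ^ 2 - 2 : ℝ) : ℂ) + 2 = ((r ^ 2 : ℝ) : ℂ) := by push_cast; ring
  rw [hc] at hq
  set x : EuclideanSpace ℂ m := toLp 2 v with hx
  set y : EuclideanSpace ℂ m := toLp 2 ((W - 1) *ᵥ v) with hy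
  have hxn : (‖x‖ ^ 2 : ℝ) = (star v ⬝ᵥ v).re := by
    rw [← inner_self_eq_norm_sq (𝕜 := ℂ), hx, EuclideanSpace.inner_toLp_toLp, dotProduct_comm]
    rfl
  have hyn : (‖y‖ ^ 2 : ℝ) = (star ((W - 1) *ᵥ v) ⬝ᵥ ((W - 1) *ᵥ v)).re := by
    rw [← inner_self_eq_norm_sq (𝕜 := ℂ), hy, EuclideanSpace.inner_toLp_toLp, dotProduct_comm]
    rfl
  have hy2 : ‖y‖ ^ 2 = r ^ 2 * ‖x‖ ^ 2 := by
    rw [hyn, hq, hxn, Complex.mul_re, Complex.ofReal_re, Complex.ofReal_im, zero_mul, sub_zero]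
  have hyx : ‖y‖ = r * ‖x‖ := by
    have h1 : ‖y‖ ^ 2 = (r * ‖x‖) ^ 2 := by rw [hy2, mul_pow]
    exact (pow_left_inj₀ (norm_nonneg _) (mul_nonneg hr (norm_nonneg _)) two_ne_zero).1 h1
  have hle : ‖y‖ ≤ ‖W - 1‖ * ‖x‖ := by
    have := Matrix.l2_opNorm_mulVec (W - 1) x
    simpa [hx, hy] using this
  have hxpos : 0 < ‖x‖ := by
    rw [norm_pos_iff]
    intro h0
    apply hv0
    have : ofLp x = 0 := by rw [h0]; rfl
    simpa [hx] using this
  rw [hyx] at hle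
  exact le_of_mul_le_mul_right hle hxpos

/-- Contrapositive of the g3 level equation: for a unitary `W`, `det((r² − 2)·1 + W + Wᴴ) ≠ 0 ⇒ ‖W − 1‖ ≠ r`.
[cite: Balaban1985Averaging, (19) p.21] [cite: HornJohnson2013, §5.6] -/
theorem norm_sub_one_ne_of_det_level_ne_zero [Nonempty m] {W : Matrix m m ℂ} (hW : W ∈ Matrix.unitaryGroup m ℂ) {r : ℝ}
    (hdet : (((r ^ 2 - 2 : ℝ) : ℂ) • (1 : Matrix m m ℂ) + W + W.conjTranspose).det ≠ 0) : ‖W - 1‖ ≠ r :=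
  fun h => hdet (det_level_eq_zero_of_norm_sub_one_eq hW h)

end LinearAlgebra

/-! ## §2 The pointwise core: local constancy of `{‖w − 1‖ < r}` from the flat-locus dichotomy of the level function -/

section Pointwise

variable {m : Type*} [Fintype m] [DecidableEq m] [Nonempty m]

/-- ★ **POINTWISE CORE**: `X` a topological space, `w : X → M_m(ℂ)` continuous at `x` and unitary-valued on a neighbourhood
of `x`; if the level function `D_r = det((r² − 2)·1 + w + wᴴ)` is either non-zero at `x` or identically zero near `x`, then
`∀ᶠ x' in 𝓝 x, (‖w x' − 1‖ < r ↔ ‖w x − 1‖ < r)`. [cite: Balaban1985Averaging, (19) p.21] [cite: HornJohnson2013, §5.6] -/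
theorem eventually_norm_sub_one_lt_iff {X : Type*} [TopologicalSpace X] {w : X → Matrix m m ℂ} {x : X} {r : ℝ}
    (hc : ContinuousAt w x) (hu : ∀ᶠ x' in 𝓝 x, w x' ∈ Matrix.unitaryGroup m ℂ)
    (hd : (((r ^ 2 - 2 : ℝ) : ℂ) • (1 : Matrix m m ℂ) + w x + (w x).conjTranspose).det ≠ 0 ∨
      ∀ᶠ x' in 𝓝 x, (((r ^ 2 - 2 : ℝ) : ℂ) • (1 : Matrix m m ℂ) + w x' + (w x').conjTranspose).det = 0) :
    ∀ᶠ x' in 𝓝 x, (‖w x' - 1‖ < r ↔ ‖w x - 1‖ < r) := by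
  rcases lt_or_ge r 0 with hr | hr
  · -- negative radius: the condition is identically false
    exact Filter.Eventually.of_forall fun x' =>
      ⟨fun h' => absurd (lt_of_le_of_lt (norm_nonneg _) h') (not_lt.2 hr.le),
        fun h' => absurd (lt_of_le_of_lt (norm_nonneg _) h') (not_lt.2 hr.le)⟩
  have hcn : ContinuousAt (fun x' => ‖w x' - 1‖) x := (hc.sub continuousAt_const).norm
  rcases hd with hne | hflat
  · -- off the level set: `‖w x − 1‖ ≠ r`, locally on the same side by continuity
    have hx : ‖w x - 1‖ ≠ r := norm_sub_one_ne_of_det_level_ne_zero (hu.self_of_nhds) hne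
    rcases lt_or_gt_of_ne hx with hlt | hgt
    · filter_upwards [hcn.eventually (gt_mem_nhds hlt)] with x' hx'
      exact ⟨fun _ => hlt, fun _ => hx'⟩
    · filter_upwards [hcn.eventually (lt_mem_nhds hgt)] with x' hx'
      exact ⟨fun h' => absurd (lt_trans hx' h') (lt_irrefl _), fun h' => absurd (lt_trans hgt h') (lt_irrefl _)⟩
  · -- on the flat locus: `r ≤ ‖w x' − 1‖` near `x` (§1), the condition is locally false
    have hge : ∀ᶠ x' in 𝓝 x, r ≤ ‖w x' - 1‖ := by
      filter_upwards [hu, hflat] with x' hu' hd'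
      exact le_norm_sub_one_of_det_level_eq_zero hu' hr hd'
    have hx : r ≤ ‖w x - 1‖ := hge.self_of_nhds
    filter_upwards [hge] with x' hx'
    exact ⟨fun h' => absurd h' (not_lt.2 hx'), fun h' => absurd h' (not_lt.2 hx)⟩

end Pointwise

/-! ## §3 A.e. local constancy of operator-norm small-field conditions on `G^ι` -/

section Generic

variable {𝔸 : Type*} [NormedRing 𝔸] [NormedAlgebra ℂ 𝔸] [CompleteSpace 𝔸]
variable {G : Type*} [Group G] [TopologicalSpace G] [IsTopologicalGroup G] [CompactSpace G]
variable {C : LogChart 𝔸} {ρ : G →* 𝔸} [FiniteDimensional ℝ C.lie]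
variable [MeasurableSpace G] [BorelSpace G] (μ : Measure G) [μ.IsHaarMeasure]
variable {m : Type*} [Fintype m] [DecidableEq m] [Nonempty m]

omit [CompleteSpace 𝔸] [Nonempty m] in
/-- The level function `x ↦ det((r² − 2)·1 + w x + (w x)ᴴ)` of a map `w` real-analytic on `W` is real-analytic on `W`
(g3's `HaarDist1LevelHypersurface.analyticOnNhd_det_level_comp`). [cite: HornJohnson2013, §0.3] -/
theorem analyticOnNhd_det_level_comp' {E : Type*} [NormedAddCommGroup E] [NormedSpace ℝ E] {W : Set E}
    {w : E → Matrix m m ℂ} (hw : AnalyticOnNhd ℝ w W) (r : ℝ) :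
    AnalyticOnNhd ℝ (fun x => (((r ^ 2 - 2 : ℝ) : ℂ) • (1 : Matrix m m ℂ) + w x + (w x).conjTranspose).det) W :=
  analyticOnNhd_det_level_comp hw _

/-- ★★★ **OPERATOR-NORM SMALL-FIELD CONDITIONS ARE A.E. LOCALLY CONSTANT**: every compact chart-represented `G`, every Haar
`μ`, finite `ι`, `W ⊆ 𝔸^ι` open, `w : 𝔸^ι → M_m(ℂ)` real-analytic on `W` and unitary-valued on the trace `ρ^ι(G^ι) ∩ W`, any
`r`: for `(⊗_ι μ)`-a.e. `g` with `ρ∘g ∈ W`, `∀ᶠ g' in 𝓝 g, (‖w(ρ∘g') − 1‖ < r ↔ ‖w(ρ∘g) − 1‖ < r)` — NO connectedness, NO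
witness, NO surjectivity of `Θ` (file 3's flat-locus theorem on the level function, §2).
[cite: Balaban1985Averaging, (19) p.21] [cite: BrockerTomDieck1985, IV (2.11) (proof), I (5.12)] [cite: Mityagin2015, Proposition 1] -/
theorem ae_pi_eventually_norm_sub_one_lt_iff (h : IsChartRep C ρ)
    (hlie : ∀ x ∈ C.lie, ∀ y ∈ C.lie, x * y - y * x ∈ C.lie) {ι : Type*} [Fintype ι] {W : Set (ι → 𝔸)}
    (hW : IsOpen W) {w : (ι → 𝔸) → Matrix m m ℂ} (hw : AnalyticOnNhd ℝ w W)
    (hu : ∀ g : ι → G, (fun i => ρ (g i)) ∈ W → w (fun i => ρ (g i)) ∈ Matrix.unitaryGroup m ℂ) (r : ℝ) :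
    ∀ᵐ g ∂(Measure.pi fun _ : ι => μ), (fun i => ρ (g i)) ∈ W →
      ∀ᶠ g' in 𝓝 g, (‖w (fun i => ρ (g' i)) - 1‖ < r ↔ ‖w (fun i => ρ (g i)) - 1‖ < r) := by
  filter_upwards [ae_pi_eventually_eq_zero_of_eq_zero μ h hlie hW (analyticOnNhd_det_level_comp' hw r)] with g hg hgW
  have hc : Continuous (fun g' : ι → G => fun i => ρ (g' i)) := continuous_rho_pi h
  have hWn : ∀ᶠ g' in 𝓝 g, (fun i => ρ (g' i)) ∈ W := hc.continuousAt.eventually (hW.mem_nhds hgW)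
  refine eventually_norm_sub_one_lt_iff (w := fun g' : ι → G => w (fun i => ρ (g' i))) ?_ ?_ ?_
  · exact (hw.continuousOn.continuousAt (hW.mem_nhds hgW)).comp hc.continuousAt
  · filter_upwards [hWn] with g' hg'
    exact hu g' hg'
  · by_cases hne : (((r ^ 2 - 2 : ℝ) : ℂ) • (1 : Matrix m m ℂ) + w (fun i => ρ (g i)) +
        (w (fun i => ρ (g i))).conjTranspose).det = 0
    · exact Or.inr (hg hgW hne)
    · exact Or.inl hne

/-- ★★ **THE SHARP CUT-OFF `𝟙[‖w − 1‖ < r]` IS A.E. CONTINUOUS** on the trace of `W`. [cite: Balaban1985Averaging, (19) p.21]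
[cite: BrockerTomDieck1985, IV (2.11) (proof), I (5.12)] [cite: Mityagin2015, Proposition 1] -/
theorem ae_pi_continuousAt_ite_norm_sub_one_lt (h : IsChartRep C ρ)
    (hlie : ∀ x ∈ C.lie, ∀ y ∈ C.lie, x * y - y * x ∈ C.lie) {ι : Type*} [Fintype ι] {W : Set (ι → 𝔸)}
    (hW : IsOpen W) {w : (ι → 𝔸) → Matrix m m ℂ} (hw : AnalyticOnNhd ℝ w W)
    (hu : ∀ g : ι → G, (fun i => ρ (g i)) ∈ W → w (fun i => ρ (g i)) ∈ Matrix.unitaryGroup m ℂ) (r : ℝ) :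
    ∀ᵐ g ∂(Measure.pi fun _ : ι => μ), (fun i => ρ (g i)) ∈ W →
      ContinuousAt (fun g' : ι → G => if ‖w (fun i => ρ (g' i)) - 1‖ < r then (1 : ℝ) else 0) g := by
  filter_upwards [ae_pi_eventually_norm_sub_one_lt_iff μ h hlie hW hw hu r] with g hg hgW
  refine (continuousAt_const (y := if ‖w (fun i => ρ (g i)) - 1‖ < r then (1 : ℝ) else 0)).congr_of_eventuallyEq ?_
  filter_upwards [hg hgW] with g' hg'
  simp only [hg']

/-- ★★ **A FINITE FAMILY OF OPERATOR-NORM CONDITIONS** (the (2.17) shape `∀ p ⊂ □̃, |w_p − 1| < ε`): for `w_p` real-analytic on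
`W` and unitary-valued on the trace, levels `r_p`, the joint condition is a.e. locally constant.
[cite: Balaban1987RG1, (2.17) p.266] [cite: Balaban1985Averaging, (19) p.21] [cite: Mityagin2015, Proposition 1] -/
theorem ae_pi_eventually_forall_norm_sub_one_lt_iff (h : IsChartRep C ρ)
    (hlie : ∀ x ∈ C.lie, ∀ y ∈ C.lie, x * y - y * x ∈ C.lie) {ι : Type*} [Fintype ι] {W : Set (ι → 𝔸)}
    (hW : IsOpen W) {P : Type*} [Finite P] {w : P → (ι → 𝔸) → Matrix m m ℂ} (hw : ∀ p, AnalyticOnNhd ℝ (w p) W)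
    (hu : ∀ p (g : ι → G), (fun i => ρ (g i)) ∈ W → w p (fun i => ρ (g i)) ∈ Matrix.unitaryGroup m ℂ) (r : P → ℝ) :
    ∀ᵐ g ∂(Measure.pi fun _ : ι => μ), (fun i => ρ (g i)) ∈ W →
      ∀ᶠ g' in 𝓝 g, (∀ p, ‖w p (fun i => ρ (g' i)) - 1‖ < r p) ↔ (∀ p, ‖w p (fun i => ρ (g i)) - 1‖ < r p) := by
  haveI : Countable P := Finite.to_countable
  have hall := ae_all_iff.2 fun p => ae_pi_eventually_norm_sub_one_lt_iff μ h hlie hW (hw p) (hu p) (r p)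
  filter_upwards [hall] with g hg hgW
  filter_upwards [eventually_all.2 fun p => hg p hgW] with g' hg'
  exact forall_congr' fun p => hg' p

end Generic

/-! ## §4 The gauge-field measure `dU = Π_b dU(b)` on `SU(N)`-configurations -/

section FieldMeasure

variable {m : Type*} [Fintype m] [DecidableEq m] [Nonempty m]
variable {N : ℕ} [NeZero N] (P : Params) (j : ℕ)

/-- The normalised Haar datum of `SU(N)` is a Haar measure. [folklore] -/
private theorem isHaarMeasure_haarData :
    (HaarData.haar : Measure (Matrix.specialUnitaryGroup (Fin N) ℂ)).IsHaarMeasure := by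
  show (Measure.haarMeasure ⊤).IsHaarMeasure
  infer_instance

/-- ★★★ **`dU`-A.E. LOCAL CONSTANCY OF A FINITE FAMILY OF (2.17)-SHAPED CONDITIONS** `∀ p, ‖w_p(U) − 1‖ < r_p`: for every
torus datum `P`, level `j`, `N ≥ 1`, every open `W ⊆ (PBond P j → M_N(ℂ))`, every finite family `w_p : (PBond P j → M_N(ℂ)) →
M_m(ℂ)` real-analytic on `W` and unitary-valued on `SU(N)`-configurations in `W`, and levels `r_p`: for `dU`-a.e. configuration
`U` in `W`, `∀ᶠ U' in 𝓝 U, (∀ p, ‖w_p U' − 1‖ < r_p) ↔ (∀ p, ‖w_p U − 1‖ < r_p)`. [cite: Balaban1987RG1, (2.17) p.266]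
[cite: Balaban1985Averaging, (10) p.19, (19) p.21] [cite: BrockerTomDieck1985, IV (2.11) (proof), I (5.12)] [cite: Mityagin2015, Proposition 1] -/
theorem fieldMeasure_ae_eventually_forall_norm_sub_one_lt_iff {W : Set (PBond P j → Matrix (Fin N) (Fin N) ℂ)}
    (hW : IsOpen W) {Q : Type*} [Finite Q] {w : Q → (PBond P j → Matrix (Fin N) (Fin N) ℂ) → Matrix m m ℂ}
    (hw : ∀ q, AnalyticOnNhd ℝ (w q) W)
    (hu : ∀ q (U : PBond P j → Matrix.specialUnitaryGroup (Fin N) ℂ),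
      (fun b => (U b : Matrix (Fin N) (Fin N) ℂ)) ∈ W →
        w q (fun b => (U b : Matrix (Fin N) (Fin N) ℂ)) ∈ Matrix.unitaryGroup m ℂ)
    (r : Q → ℝ) :
    ∀ᵐ U : PBond P j → Matrix.specialUnitaryGroup (Fin N) ℂ ∂(fieldMeasure P j (Matrix.specialUnitaryGroup (Fin N) ℂ)),
      (fun b => (U b : Matrix (Fin N) (Fin N) ℂ)) ∈ W →
        ∀ᶠ U' in 𝓝 U,
          (∀ q, ‖w q (fun b => ((U' b : Matrix.specialUnitaryGroup (Fin N) ℂ) : Matrix (Fin N) (Fin N) ℂ)) - 1‖ < r q) ↔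
            (∀ q, ‖w q (fun b => (U b : Matrix (Fin N) (Fin N) ℂ)) - 1‖ < r q) := by
  haveI := isHaarMeasure_haarData (N := N)
  exact ae_pi_eventually_forall_norm_sub_one_lt_iff _ (isChartRep_specialUnitaryGroup (n := Fin N))
    (lie_adStable_specialUnitaryGroup (n := Fin N)) hW hw hu r

open scoped Classical in
/-- ★★ **`dU`-A.E. CONTINUITY OF THE SHARP SMALL-FIELD CHARACTERISTIC FUNCTION** `𝟙[∀ p, ‖w_p(U) − 1‖ < r_p]` on `W`.
[cite: Balaban1987RG1, (2.17) p.266] [cite: Balaban1985Averaging, (10) p.19, (19) p.21]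
[cite: BrockerTomDieck1985, IV (2.11) (proof), I (5.12)] [cite: Mityagin2015, Proposition 1] -/
theorem fieldMeasure_ae_continuousAt_ite_forall_norm_sub_one_lt {W : Set (PBond P j → Matrix (Fin N) (Fin N) ℂ)}
    (hW : IsOpen W) {Q : Type*} [Finite Q] {w : Q → (PBond P j → Matrix (Fin N) (Fin N) ℂ) → Matrix m m ℂ}
    (hw : ∀ q, AnalyticOnNhd ℝ (w q) W)
    (hu : ∀ q (U : PBond P j → Matrix.specialUnitaryGroup (Fin N) ℂ),
      (fun b => (U b : Matrix (Fin N) (Fin N) ℂ)) ∈ W →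
        w q (fun b => (U b : Matrix (Fin N) (Fin N) ℂ)) ∈ Matrix.unitaryGroup m ℂ)
    (r : Q → ℝ) :
    ∀ᵐ U : PBond P j → Matrix.specialUnitaryGroup (Fin N) ℂ ∂(fieldMeasure P j (Matrix.specialUnitaryGroup (Fin N) ℂ)),
      (fun b => (U b : Matrix (Fin N) (Fin N) ℂ)) ∈ W →
        ContinuousAt (fun U' : PBond P j → Matrix.specialUnitaryGroup (Fin N) ℂ =>
          if ∀ q, ‖w q (fun b => (U' b : Matrix (Fin N) (Fin N) ℂ)) - 1‖ < r q then (1 : ℝ) else 0) U := by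
  filter_upwards [fieldMeasure_ae_eventually_forall_norm_sub_one_lt_iff P j hW hw hu r] with U hU hUW
  refine (continuousAt_const
    (y := if ∀ q, ‖w q (fun b => (U b : Matrix (Fin N) (Fin N) ℂ)) - 1‖ < r q then (1 : ℝ) else 0)).congr_of_eventuallyEq ?_
  filter_upwards [hU hUW] with U' hU'
  simp only [hU']

end FieldMeasure

end Literature.MathematicalPhysics.QuantumFieldTheory.Balaban1983to89.HaarAnalyticZeroSetNullLocalNormThreshold

end
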